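import Summits.CriticalPhenomena.Ising3DConformalLimit.Theorems.RotationUpgradeFromTwoPoint.Negative.NondegeneracyRedundant
import Summits.CriticalPhenomena.Ising3DConformalLimit.Theses.HyperoctahedralRP

/-!
# `InversionUpgradeNormalised` (item stmt-CriticalPhenomena-1982): (H4) and the translation half of (H5) are NOT load-bearing — the bare core

Structural knowledge about the crux
`Summit.CriticalPhenomena.Ising3DConformalLimit.Theses.HyperoctahedralRP.InversionUpgradeNormalised`
(standing crux disprover, cycle 3; THEOREM-ONLY). Hypotheses on `(ρ, Δ, S)`: (H1) `ρ > 0` on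
`(0,1]`; (H2) `HasPointwiseScalingLimit (criticalCorr 3) ρ S`; (H3) `S = 0` off `NonCoincident`;
(H4) `IsNondegenerateTwoPoint S`; (H5) `IsEuclideanInvariant S` (translations ∧ `O(3)`);
(H6) `IsScaleCovariant Δ S`; conclusion `IsInversionCovariant Δ S`.

* `isInversionCovariant_of_degenerate`: a DEGENERATE instance (`¬` (H4)) is the trivial family
  `S = (1, 0, 0, …)` and satisfies the conclusion — `S₂ ≥ 0` in the limit (Griffiths I) so `S₂ = 0`
  at one pair, transported to every pair by translation + dilation + rotation
  (`RotationUpgradeFromTwoPointNegative.two_eq_zero_of_degenerate`, the sibling disprover's lemma for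
  crux stmt-8367); then `0 ≤ S₄ ≤ Σ S₂S₂ = 0` (Griffiths I and Lebowitz in the limit), `U₄ ≡ 0`, and
  the Aizenman–Newman dichotomy kills every even order `≥ 4`; odd orders vanish anyway
  (`eq_zero_of_degenerate`).
* `crux_iff_withoutNondegeneracy`: hence the crux is EQUIVALENT to its version with (H4) deleted —
  (H4) only excludes junk renormalisations `ρ`, none of which endangers the conclusion (this
  completes the load-bearing table of `LoadBearingHypotheses.lean`: (H2), (H3), (H6) load-bearing;
  (H1) sign-insensitive; (H4) redundant).
* `crux_iff_bare`: the translation half of (H5) is AUTOMATIC from (H2)+(H3)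
  (`RotationUpgradeFromTwoPointNegative.translation_redundant`: lattice translation invariance passes
  to normalised pointwise limits), so **the crux is equivalent to its BARE CORE
  "(H1) + (H2) + (H3) + `O(3)` invariance + (H6) ⇒ inversion covariance"**: lattice clause,
  normalisation and ROTATION invariance are the whole content ((H6) with SOME exponent is itself
  automatic for non-degenerate limits, `scale_redundant`, and the exponent is then forced,
  `weight_unique_of_two`; it stays in the core only to name `Δ` in the conclusion).
-/

noncomputable section

namespace Summit.CriticalPhenomena.Ising3DConformalLimit.InversionUpgradeNormalisedNegative

open Literature.Probability.LatticeModels EuclideanGeometry Function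
open Summit.CriticalPhenomena.Ising3DConformalLimit.RotationUpgradeFromTwoPointNegative
  (two_eq_zero_of_degenerate limit_nonneg pairingSum_zero_kernel translation_redundant)
open Summit.CriticalPhenomena.Ising3DConformalLimit.Theses.HyperoctahedralRP (InversionUpgradeNormalised)

variable {ρ : ℝ → ℝ} {Δ : ℝ} {S : CorrFamily 3}

/-- `O(3)` invariance of the family gives the two-point isotropy clause used by the sibling
lemmas (`S₂(0, R x) = S₂(0, x)`). [folklore] -/
theorem two_point_iso_of_isRotationInvariant (hrot : IsRotationInvariant S)
    (R : EuclideanSpace ℝ (Fin 3) ≃ₗᵢ[ℝ] EuclideanSpace ℝ (Fin 3)) (x : EuclideanSpace ℝ (Fin 3))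
    (_hx : x ≠ 0) : S 2 ![0, R x] = S 2 ![0, x] := by
  have h := hrot 2 R ![0, x]
  have e : (fun i => R ((![0, x] : Fin 2 → EuclideanSpace ℝ (Fin 3)) i)) = ![0, R x] := by
    funext i; fin_cases i <;> simp
  rw [e] at h
  exact h

/-- **A degenerate instance is trivial**: under (H1)–(H3), `O(3)` invariance and (H6), if (H4)
FAILS then `S_n ≡ 0` for every `n ≥ 1` (all configurations, coincident ones by (H3)).
[cite: AizenmanCDM2020, §7, Prop. 7.2] -/
theorem eq_zero_of_degenerate (hρ : ∀ δ ∈ Set.Ioc (0:ℝ) 1, 0 < ρ δ)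
    (hlim : HasPointwiseScalingLimit (criticalCorr 3) ρ S)
    (hnorm : ∀ n z, z ∉ NonCoincident 3 n → S n z = 0) (hrot : IsRotationInvariant S)
    (hsc : IsScaleCovariant Δ S) (hdeg : ¬ IsNondegenerateTwoPoint S)
    {n : ℕ} (hn : 1 ≤ n) (x : Fin n → EuclideanSpace ℝ (Fin 3)) : S n x = 0 := by
  have htr : IsTranslationInvariant S := translation_redundant hlim hnorm
  have h2 : ∀ y, S 2 y = 0 :=
    two_eq_zero_of_degenerate hρ hlim hnorm htr hsc (two_point_iso_of_isRotationInvariant hrot) hdeg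
  -- `S₄ ≡ 0` on non-coincident quadruples, hence `U₄ ≡ 0` there
  have hU : ∀ z ∈ NonCoincident 3 4, limitConnectedFour S z = 0 := by
    intro z hz
    have hle := limitConnectedFour_nonpos_of_hasPointwiseScalingLimit (by norm_num) hlim hz
    have hge : 0 ≤ S 4 z := limit_nonneg hρ hlim hz
    simp only [limitConnectedFour, h2, mul_zero, add_zero, sub_zero] at hle ⊢
    exact le_antisymm hle hge
  rcases Nat.even_or_odd n with hev | hodd
  · obtain ⟨m, rfl⟩ : ∃ m, n = 2 * m := by
      obtain ⟨r, hr⟩ := hev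
      exact ⟨r, by omega⟩
    rcases Nat.lt_or_ge m 2 with hm | hm
    · interval_cases m
      · omega
      · exact h2 x
    · by_cases hx : x ∈ NonCoincident 3 (2 * m)
      · rw [hlim.eq_pairingSum_of_limitConnectedFour_eq_zero (by norm_num) hU hm hx]
        have hk : (fun p q : EuclideanSpace ℝ (Fin 3) => S 2 ![p, q]) = fun _ _ => (0:ℝ) := by
          funext p q; exact h2 _
        rw [hk]
        exact pairingSum_zero_kernel (by omega) x
      · exact hnorm _ x hx
  · exact limit_odd_eq_zero hlim hnorm hodd x

/-- **A degenerate instance satisfies the conclusion**: it is inversion covariant with every weight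
(both sides of each identity of order `≥ 1` vanish; order `0` is empty). [folklore] -/
theorem isInversionCovariant_of_degenerate (hρ : ∀ δ ∈ Set.Ioc (0:ℝ) 1, 0 < ρ δ)
    (hlim : HasPointwiseScalingLimit (criticalCorr 3) ρ S)
    (hnorm : ∀ n z, z ∉ NonCoincident 3 n → S n z = 0) (hrot : IsRotationInvariant S)
    (hsc : IsScaleCovariant Δ S) (hdeg : ¬ IsNondegenerateTwoPoint S) :
    IsInversionCovariant Δ S := by
  intro n x _hx
  rcases Nat.eq_zero_or_pos n with rfl | hn
  · have hfun : (fun i => inversion (0 : EuclideanSpace ℝ (Fin 3)) 1 (x i)) = x :=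
      funext fun i => i.elim0
    simp [hfun]
  · rw [eq_zero_of_degenerate hρ hlim hnorm hrot hsc hdeg hn,
      eq_zero_of_degenerate hρ hlim hnorm hrot hsc hdeg hn, mul_zero]

/-- **(H4) is NOT load-bearing**: the crux is equivalent to its version WITHOUT the non-degeneracy
hypothesis. [folklore] -/
theorem crux_iff_withoutNondegeneracy :
    InversionUpgradeNormalised ↔
      ∀ (ρ : ℝ → ℝ) (Δ : ℝ) (S : CorrFamily 3), (∀ δ ∈ Set.Ioc (0:ℝ) 1, 0 < ρ δ) →
        HasPointwiseScalingLimit (criticalCorr 3) ρ S → (∀ n z, z ∉ NonCoincident 3 n → S n z = 0) →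
        IsEuclideanInvariant S → IsScaleCovariant Δ S → IsInversionCovariant Δ S := by
  constructor
  · intro h ρ Δ S h1 h2 h3 h5 h6
    by_cases h4 : IsNondegenerateTwoPoint S
    · exact h ρ Δ S h1 h2 h3 h4 h5 h6
    · exact isInversionCovariant_of_degenerate h1 h2 h3 h5.2 h6 h4
  · intro h ρ Δ S h1 h2 h3 _ h5 h6
    exact h ρ Δ S h1 h2 h3 h5 h6

/-- **THE BARE CORE.** The crux is equivalent to
"(H1) + (H2) + (H3) + `O(3)` invariance + (H6) ⇒ inversion covariance": (H4) is redundant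
(`crux_iff_withoutNondegeneracy`) and translation invariance is automatic for normalised pointwise
limits of the critical correlators (`translation_redundant`). The whole content of the crux is: the
lattice clause, the normalisation, ROTATION invariance (the sibling crux of the route) and the name
of the exponent. [folklore] -/
theorem crux_iff_bare :
    InversionUpgradeNormalised ↔
      ∀ (ρ : ℝ → ℝ) (Δ : ℝ) (S : CorrFamily 3), (∀ δ ∈ Set.Ioc (0:ℝ) 1, 0 < ρ δ) →
        HasPointwiseScalingLimit (criticalCorr 3) ρ S → (∀ n z, z ∉ NonCoincident 3 n → S n z = 0) →
        IsRotationInvariant S → IsScaleCovariant Δ S → IsInversionCovariant Δ S := by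
  rw [crux_iff_withoutNondegeneracy]
  constructor
  · intro h ρ Δ S h1 h2 h3 hrot h6
    exact h ρ Δ S h1 h2 h3 ⟨translation_redundant h2 h3, hrot⟩ h6
  · intro h ρ Δ S h1 h2 h3 h5 h6
    exact h ρ Δ S h1 h2 h3 h5.2 h6

end Summit.CriticalPhenomena.Ising3DConformalLimit.InversionUpgradeNormalisedNegative

end
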